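import Summits.ResolutionOfSingularities.ResolutionOfSingularities.Theorems.UniversalCellsDefs

/-!
# Reindexing the partial matroid stratum ring (crux `UniversalCells.Universality`, line `birth`)

Stub `stub_stratumReindex` of the skeleton `Universality` for crux
stmt-ResolutionOfSingularities-15234: the partial matroid stratum ring
`S = 𝔽_p[a_{ik}] ⧸ ⟨Γ₀-minors of [I₃ | A]⟩ [1 / ∏_{u ∈ Γ₊} minor_u]` built on a structured column
index type `κ` (`StratumRing' p κ Γp Γ0`) is isomorphic to the one built on `Fin m`
(`StratumRing p m …`) after transporting everything along a bijection `e : κ ≃ Fin m`: rename the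
variables `(i, k) ↦ (i, e k)` and push the column selectors `u ↦ Sum.map id e ∘ u`.

Proof. The renaming `φ = MvPolynomial.renameEquiv _ (Equiv.refl (Fin 3) ×ˢ e)` maps the
tautological matrix `[I₃ | A]` over `κ`, restricted to the columns `u`, entrywise to `[I₃ | A]` over
`Fin m` restricted to the columns `Sum.map id e ∘ u`; hence (`AlgEquiv.map_det`) it maps minors to
minors, the `Γ₀`-minor ideal onto the pushed-forward minor ideal (`Ideal.map_span`), and the
inverted product of `Γ₊`-minors to the product over the image finset (`Finset.prod_image`, the
push-forward of selectors being injective). `Ideal.quotientEquiv` and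
`IsLocalization.ringEquivOfRingEquiv` turn this into the ring isomorphism.
-/

-- single-problem summit: the doubled namespace component `ResolutionOfSingularities` is forced
set_option linter.dupNamespace false

noncomputable section

namespace Summit.ResolutionOfSingularities.ResolutionOfSingularities.Theorems.UniversalCells

namespace StratumReindex

/-- The variable renaming `(i, k) ↦ (i, e k)` sends the minor of `[I₃ | A]` on the column triple
`u` to the minor of `[I₃ | A]` (columns indexed by `Fin m`) on the pushed-forward triple
`Sum.map id e ∘ u`. [folklore] -/
theorem renameEquiv_minor' (p : ℕ) (κ : Type) (m : ℕ) (e : κ ≃ Fin m) (u : Fin 3 → Fin 3 ⊕ κ) :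
    MvPolynomial.renameEquiv (ZMod p) ((Equiv.refl (Fin 3)).prodCongr e) (minor' p κ u) =
      ((tautMatrix p m).submatrix id (Sum.map id e ∘ u)).det := by
  rw [AlgEquiv.map_det]
  congr 1
  refine Matrix.ext fun i j => ?_
  simp only [AlgEquiv.mapMatrix_apply, Matrix.map_apply, Matrix.submatrix_apply, id_eq,
    Function.comp_apply]
  cases u j with
  | inl a =>
    simp only [Sum.map_inl, id_eq, Matrix.fromCols_apply_inl, Matrix.one_apply]
    split_ifs <;> simp
  | inr k => simp [Matrix.fromCols_apply_inr, MvPolynomial.rename_X]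

/-- Pushing selectors forward along a bijection of column indices is injective. [folklore] -/
theorem push_injective (κ : Type) (m : ℕ) (e : κ ≃ Fin m) :
    Function.Injective (fun u : Fin 3 → Fin 3 ⊕ κ => Sum.map id e ∘ u) := by
  intro u v huv
  funext j
  exact Sum.map_injective.mpr ⟨Function.injective_id, e.injective⟩ (congrFun huv j)

/-- Functoriality of `Localization.Away` along a ring isomorphism (the skeleton's `awayCongr`).
[folklore] -/
theorem awayCongr {A A' : Type} [CommRing A] [CommRing A'] (f : A ≃+* A') (a : A) (a' : A')
    (h : f a = a') : Nonempty (Localization.Away a ≃+* Localization.Away a') :=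
  ⟨IsLocalization.ringEquivOfRingEquiv (M := Submonoid.powers a) (T := Submonoid.powers a')
    (Localization.Away a) (Localization.Away a') f
    (by rw [Submonoid.map_powers]; simp [h])⟩

end StratumReindex

/-- REINDEXING of the partial matroid stratum ring along a bijection of column indices
`e : κ ≃ Fin m`: rename the variables `(i, k) ↦ (i, e k)` and push the selectors
`u ↦ Sum.map id e ∘ u`. [folklore] -/
theorem stub_stratumReindex (p : ℕ) (κ : Type) [Fintype κ] [DecidableEq κ] (m : ℕ) (e : κ ≃ Fin m) (Γp : Finset (Fin 3 → Fin 3 ⊕ κ)) (Γ0 : Set (Fin 3 → Fin 3 ⊕ κ)) : Nonempty (StratumRing' p κ Γp Γ0 ≃+* StratumRing p m (Γp.image fun u => Sum.map id e ∘ u) ((fun u => Sum.map id e ∘ u) '' Γ0)) := by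
  -- the variable renaming `(i, k) ↦ (i, e k)`, a ring isomorphism mapping minors to minors
  obtain ⟨φ, hφ⟩ :
      ∃ φ : MvPolynomial (Fin 3 × κ) (ZMod p) ≃+* MvPolynomial (Fin 3 × Fin m) (ZMod p),
        ∀ u : Fin 3 → Fin 3 ⊕ κ,
          φ (minor' p κ u) = ((tautMatrix p m).submatrix id (Sum.map id e ∘ u)).det :=
    ⟨(MvPolynomial.renameEquiv (ZMod p) ((Equiv.refl (Fin 3)).prodCongr e)).toRingEquiv,
      fun u => StratumReindex.renameEquiv_minor' p κ m e u⟩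
  -- it maps the `Γ₀`-minor ideal onto the pushed-forward minor ideal
  have hIJ : minorIdeal p m ((fun u => Sum.map id e ∘ u) '' Γ0) =
      (Ideal.span (minor' p κ '' Γ0)).map (φ : _ →+* _) := by
    rw [Ideal.map_span, Set.image_image]
    unfold minorIdeal
    rw [Set.image_image]
    exact congrArg Ideal.span (Set.image_congr fun u _ => (hφ u).symm)
  -- and the inverted product of `Γ₊`-minors to the inverted product over the image finset
  refine StratumReindex.awayCongr
    (Ideal.quotientEquiv (Ideal.span (minor' p κ '' Γ0))
      (minorIdeal p m ((fun u => Sum.map id e ∘ u) '' Γ0)) φ hIJ) _ _ ?_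
  rw [Ideal.quotientEquiv_mk, map_prod,
    Finset.prod_image (StratumReindex.push_injective κ m e).injOn]
  simp only [hφ]

end Summit.ResolutionOfSingularities.ResolutionOfSingularities.Theorems.UniversalCells

end
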